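import Summits.Ventures.PercRepro.C012Reduction

/-!
# "(BX) ⇒ C-012" with (BX) stated for b-edges only

`BX` is the cross-term condition of `proofs/P5-C012.md` §7 exactly as the census tests it: for every
marked multigraph and every free edge `e` INCIDENT TO `b`, the polarised C-012 slack between
`p[e:=0]` and `p[e:=1]` is at least `−min` of the two endpoint slacks.

* `MultiGraph.law3_congr_of_sure`: re-marking — if `P(b ~ u) = 1` the rows of `(a, b, c)` and
  `(a, u, c)` coincide (events agree on the support).
* `weight_ne_zero_of_update`, `prob_connEvent_update_eq_one`: a sure connection stays sure after
  fixing a free edge to `0` or `1` (the support shrinks).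
* `BXgen_of_BX`: the sure-cluster form `BXgen` follows from the b-edge form `BX`.
* `C012_of_BX : BX → C012`.
-/

namespace PercRepro

open Finset

/-- **The condition (BX), b-edge form**: for every free edge `e` incident to `b`,
`𝔅(L(p[e:=0]), L(p[e:=1])) ≥ −min(S(p[e:=0]), S(p[e:=1]))`. -/
def BX : Prop :=
  ∀ {V E : Type} [Fintype E] [DecidableEq E] (G : MultiGraph V E) (p : E → ℝ), IsProb p →
    ∀ a b c : V, ∀ e : E, 0 < p e → p e < 1 → (G.fst e = b ∨ G.snd e = b) →
      -min (c012Slack (G.law3 (Function.update p e 0) a b c))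
          (c012Slack (G.law3 (Function.update p e 1) a b c)) ≤
        c012Bil (G.law3 (Function.update p e 0) a b c) (G.law3 (Function.update p e 1) a b c)

variable {E : Type*} [Fintype E] [DecidableEq E]

/-- Fixing a free edge shrinks the support: `w_{p[e:=x]}(ω) ≠ 0 ⇒ w_p(ω) ≠ 0` for `x ∈ {0, 1}`. -/
theorem weight_ne_zero_of_update {p : E → ℝ} (hp : IsProb p) {e : E} (hpe0 : 0 < p e)
    (hpe1 : p e < 1) {x : ℝ} (hx : x = 0 ∨ x = 1) {ω : Config E}
    (hω : weight (Function.update p e x) ω ≠ 0) : weight p ω ≠ 0 := by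
  have hs := weight_split p e ω
  have h0 : 0 ≤ weight (Function.update p e 0) ω :=
    weight_nonneg (hp.update e ⟨le_rfl, zero_le_one⟩) ω
  have h1 : 0 ≤ weight (Function.update p e 1) ω :=
    weight_nonneg (hp.update e ⟨zero_le_one, le_rfl⟩) ω
  rcases hx with rfl | rfl
  · have hpos : 0 < weight (Function.update p e 0) ω := lt_of_le_of_ne h0 (Ne.symm hω)
    have : 0 < weight p ω := by
      rw [hs]; nlinarith [mul_nonneg hpe0.le h1]
    exact this.ne'
  · have hpos : 0 < weight (Function.update p e 1) ω := lt_of_le_of_ne h1 (Ne.symm hω)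
    have : 0 < weight p ω := by
      rw [hs]; nlinarith [mul_nonneg (sub_nonneg.2 hpe1.le) h0]
    exact this.ne'

namespace MultiGraph

variable {V : Type*} (G : MultiGraph V E)

/-- A sure connection stays sure after fixing a free edge to `0` or `1`. -/
theorem prob_connEvent_update_eq_one {p : E → ℝ} (hp : IsProb p) {e : E} (hpe0 : 0 < p e)
    (hpe1 : p e < 1) {x : ℝ} (hx : x = 0 ∨ x = 1) {b u : V}
    (hbu : prob p (G.connEvent b u) = 1) :
    prob (Function.update p e x) (G.connEvent b u) = 1 := by
  apply prob_eq_one_of_forall_mem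
  intro ω hω
  exact mem_of_prob_eq_one hp hbu (weight_ne_zero_of_update hp hpe0 hpe1 hx hω)

/-- **Re-marking**: if `b` is surely connected to `u`, the rows of `(a, b, c)` and `(a, u, c)`
coincide. -/
theorem law3_congr_of_sure {q : E → ℝ} (hq : IsProb q) (a b c u : V)
    (hbu : prob q (G.connEvent b u) = 1) : G.law3 q a b c = G.law3 q a u c := by
  funext s
  unfold law3
  apply prob_congr_of_support
  intro ω hω
  have hconn : G.Conn ω b u := (mem_connEvent G).1 (mem_of_prob_eq_one hq hbu hω)
  have h1 : G.Conn ω a b ↔ G.Conn ω a u :=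
    ⟨fun h => h.trans hconn, fun h => h.trans hconn.symm⟩
  have h2 : G.Conn ω b c ↔ G.Conn ω u c :=
    ⟨fun h => hconn.symm.trans h, fun h => hconn.trans h⟩
  rw [mem_partitionEvent_three, mem_partitionEvent_three, h1, h2]

end MultiGraph

/-- The sure-cluster form of (BX) follows from the b-edge form by re-marking `b` to the surely
connected endpoint of `e`. -/
theorem BXgen_of_BX (h : BX) : BXgen := by
  intro V E _ _ G p hp a b c e hpe0 hpe1 htouch
  have hp0 : IsProb (Function.update p e 0) := hp.update e ⟨le_rfl, zero_le_one⟩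
  have hp1 : IsProb (Function.update p e 1) := hp.update e ⟨zero_le_one, le_rfl⟩
  rcases htouch with hu | hu
  · have key := h G p hp a (G.fst e) c e hpe0 hpe1 (Or.inl rfl)
    rw [← G.law3_congr_of_sure hp0 a b c (G.fst e)
        (G.prob_connEvent_update_eq_one hp hpe0 hpe1 (Or.inl rfl) hu),
      ← G.law3_congr_of_sure hp1 a b c (G.fst e)
        (G.prob_connEvent_update_eq_one hp hpe0 hpe1 (Or.inr rfl) hu)] at key
    exact key
  · have key := h G p hp a (G.snd e) c e hpe0 hpe1 (Or.inr rfl)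
    rw [← G.law3_congr_of_sure hp0 a b c (G.snd e)
        (G.prob_connEvent_update_eq_one hp hpe0 hpe1 (Or.inl rfl) hu),
      ← G.law3_congr_of_sure hp1 a b c (G.snd e)
        (G.prob_connEvent_update_eq_one hp hpe0 hpe1 (Or.inr rfl) hu)] at key
    exact key

/-- **(BX) for b-edges implies C-012.** -/
theorem C012_of_BX (h : BX) : C012 :=
  C012_of_BXgen (BXgen_of_BX h)

end PercRepro
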